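import Summits.CriticalPhenomena.CardyFormulaZ2.Theorems.CardySusyWardWeakHolomorphyKirchhoffIdentity
import Summits.CriticalPhenomena.CardyFormulaZ2.Theorems.WeakHolomorphy.Negative.StaggeredBisectorTelescope

/-!
# The staggered Kirchhoff defect of the spin-`1/3` dart observable IS the corner sum of the spin-`−5/3` dart observable

Line `Sketch` of the crux `CardySusyWard.WeakHolomorphy` (stmt-CriticalPhenomena-11292), lead c3 (infrastructure,
`--supports`).  The signed combination `K^s_p = F(NE)+F(SW)−F(NW)−F(SE)` of the four spin-`1/3` dart observables at a medial
vertex `p` (the quantity the crux pairs with `∂φ`, `weakHolomorphy_iff_weakKirchhoff`) carries the corner sign `(−1)^{k+1}`;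
along the exploration path the corner index of the `j`-th dart has the parity of the start corner's index plus the number of
quarter turns `C_j` (`snd_cornerOrbit_eq`: the face index records the direction), so `(−1)^{k+1} = ε₀ (−1)^{C_j}` with ONE
sign `ε₀ = (−1)^{c₀.2 + 1}` for the whole path, and `(−1)^{C} e^{-iπC/6} = e^{i5πC/6}` (`stagger_entry_phase_eq_spin_shift`):
pathwise and then in expectation,
  `F^{(1/3)}(NE) + F^{(1/3)}(SW) − F^{(1/3)}(NW) − F^{(1/3)}(SE) = ε₀ · Σ_{k} F^{(−5/3)}(c_{p,k})`
(`staggeredKirchhoff_eq_spinShift`; `F^{(σ)} = bondDartObservable E δ σ`), at EVERY medial vertex of admissible data.  Hence the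
crux is the weak vanishing, at the spin-`1/3` normalisation `δ^{5/3}`, of the vertex-summed spin-`−5/3` ALIAS of the
observable — the dart-observable, unconditional form of `Cruxes/WeakHolomorphy/Disproof.lean` §D (there for Smirnov's entry
observable, conditional on exact vertex relations); Coulomb-gas heuristic: two-arm dimension `1/4 + 3s²/4 = 7/3 > 2` at
`s = −5/3`, numerically the crux quantity decays like `δ²` relative.  General-spin bridge `dartPhaseSum_explorationList_spin`.
References: Duminil-Copin–Smirnov arXiv:1109.1549 §8.3; Smirnov, Ann. Math. 172 (2010) §4 (direction = winding mod 4).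
-/

noncomputable section

namespace Summit.CriticalPhenomena.CardyFormulaZ2.Theorems.WeakHolomorphy.SplitBypass

open scoped BigOperators
open MeasureTheory Complex
open _root_.Literature.Probability.LatticeModels
open _root_.Literature.Probability.Percolation (BondConfig bondPercolation half)
open _root_.Literature.Barriers.CriticalPhenomena (medialCornersAt medialVertexOf)
open _root_.Literature.Probability.LatticeModels.DiscreteDobrushin (startCorner exitTime isStartCorner_startCorner
  medialExploration_eq_explorationList)

/-! ## The general-spin bridge: dart phase sums of a cut orbit -/

section Bridge

variable {β : BondConfig (Site 2)} {c₀ : Site 2 × Fin 4}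

/-- **The spin-`σ` dart phase sum of the cut orbit at a coded corner** (`dartPhaseSum_explorationList` for every spin): the
darts carried by the corner `r` sit at the positions `j < N` with `orb j = r`, and the polyline winding up to such a dart is
`(π/2)·turnCount j`, so the phase is `exp(−iσ(π/2) C_j)`. [cite: DuminilCopin2012Parafermion, Definition 3] -/
theorem dartPhaseSum_explorationList_spin {δ : ℝ} (hδ : δ ≠ 0) (σ : ℝ) (N : ℕ) (r : Site 2 × Fin 4) :
    Parafermion.dartPhaseSum (explorationList β c₀ N) δ σ (r.1, cFace r) =
      ∑ j ∈ (Finset.range N).filter (fun j => cornerOrbit β c₀ j = r),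
        Complex.exp (-Complex.I * σ * ((Real.pi / 2 * (turnCount β c₀ j : ℝ) : ℝ) : ℂ)) := by
  unfold Parafermion.dartPhaseSum
  have hlen := length_explorationList' (β := β) (c₀ := c₀) N
  have hfilt : (Finset.range (explorationList β c₀ N).length).filter
      (fun k => (explorationList β c₀ N)[k]? = some (cornerSource (r.1, cFace r).1 (r.1, cFace r).2) ∧
        (explorationList β c₀ N)[k + 1]? = some (cornerTarget (r.1, cFace r).1 (r.1, cFace r).2)) =
      (Finset.range N).filter (fun k => cornerOrbit β c₀ k = r) := by
    ext k
    simp only [Finset.mem_filter, Finset.mem_range, hlen]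
    rw [cornerSource_cFace, cornerTarget_cFace]
    constructor
    · rintro ⟨hk, h1, h2⟩
      have hk1 : k + 1 < N + 1 := by
        by_contra h
        rw [List.getElem?_eq_none (by rw [hlen]; omega)] at h2
        simp at h2
      rw [List.getElem?_eq_getElem (by rw [hlen]; omega), getElem_explorationList', Option.some.injEq] at h1
      rw [List.getElem?_eq_getElem (by rw [hlen]; exact hk1), getElem_explorationList', Option.some.injEq] at h2
      change cSrc (nextCorner β (cornerOrbit β c₀ k)) = cTgt r at h2
      rw [cSrc_nextCorner] at h2
      exact ⟨by omega, eq_of_cSrc_eq_of_cTgt_eq h1 h2⟩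
    · rintro ⟨hk, rfl⟩
      refine ⟨by omega, ?_, ?_⟩
      · rw [List.getElem?_eq_getElem (by rw [hlen]; omega), getElem_explorationList']
      · rw [List.getElem?_eq_getElem (by rw [hlen]; omega), getElem_explorationList']
        change some (cSrc (nextCorner β (cornerOrbit β c₀ k))) = _
        rw [cSrc_nextCorner]
  rw [hfilt]
  refine Finset.sum_congr rfl fun k hk => ?_
  rw [Finset.mem_filter, Finset.mem_range] at hk
  rw [Polyline.winding_eq_winding, map_medialPoint_explorationList, show k + 2 = (k + 1) + 1 from rfl,
    take_orbitPts δ c₀ (Nat.succ_le_of_lt hk.1), winding_orbitPts hδ, Nat.succ_sub_one, sum_turnOf_eq]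
  have hC : (∑ i ∈ Finset.range k, (turnSign β (cornerOrbit β c₀ i) : ℝ)) = (turnCount β c₀ k : ℝ) := by
    rw [turnCount]; push_cast; rfl
  rw [hC]

/-- Parity bookkeeping in `Fin 4`: `(a − b).val ≡ a.val + b.val (mod 2)`. [folklore] -/
theorem fin4_sub_val_mod_two : ∀ a b : Fin 4, (a - b).val % 2 = (a.val + b.val) % 2 := by decide

/-- **The parity of the turn count is the parity of the corner index** (relative to the start corner): `(−1)^{C_j} =
(−1)^{(orb j).2 + c₀.2}` (`turnCount_emod_four`: `C_j ≡ (orb j).2 − c₀.2 (mod 4)`). [cite: Smirnov2010, Lemma 4.1] -/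
theorem neg_one_zpow_turnCount (j : ℕ) :
    (-1 : ℂ) ^ (turnCount β c₀ j) = (-1) ^ ((cornerOrbit β c₀ j).2.val + c₀.2.val) := by
  have h := turnCount_emod_four (β := β) (c₀ := c₀) j
  have hdecomp : turnCount β c₀ j = (dartDir c₀ (cornerOrbit β c₀ j) : ℤ) + 4 * (turnCount β c₀ j / 4) := by
    omega
  rw [hdecomp, zpow_add₀ (by norm_num : (-1 : ℂ) ≠ 0), zpow_mul, zpow_natCast]
  have h4 : ((-1 : ℂ) ^ (4 : ℤ)) = 1 := by norm_num
  rw [h4, one_zpow, mul_one]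
  unfold dartDir
  rw [neg_one_pow_eq_pow_mod_two, fin4_sub_val_mod_two, ← neg_one_pow_eq_pow_mod_two]

end Bridge

/-! ## The pathwise identity at a medial vertex -/

section Pathwise

variable {β : BondConfig (Site 2)} {c₀ : Site 2 × Fin 4}

/-- One coded corner: the corner-signed spin-`1/3` phase sum equals `(−1)^{r.2 + c₀.2}` times the spin-`−5/3` phase sum
(termwise `(−1)^{C} e^{-iπC/6} = e^{i5πC/6}`). [folklore] -/
theorem signed_dartPhaseSum_third_eq {δ : ℝ} (hδ : δ ≠ 0) (N : ℕ) (r : Site 2 × Fin 4) :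
    (-1 : ℂ) ^ (r.2.val + c₀.2.val) * Parafermion.dartPhaseSum (explorationList β c₀ N) δ (1 / 3) (r.1, cFace r) =
      Parafermion.dartPhaseSum (explorationList β c₀ N) δ (-5 / 3) (r.1, cFace r) := by
  rw [dartPhaseSum_explorationList_spin hδ, dartPhaseSum_explorationList_spin hδ, Finset.mul_sum]
  refine Finset.sum_congr rfl fun j hj => ?_
  rw [Finset.mem_filter] at hj
  have hpar : (-1 : ℂ) ^ (r.2.val + c₀.2.val) = (-1 : ℂ) ^ (turnCount β c₀ j) := by
    rw [neg_one_zpow_turnCount j, hj.2]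
  rw [hpar, show -Complex.I * ((1 / 3 : ℝ) : ℂ) * ((Real.pi / 2 * (turnCount β c₀ j : ℝ) : ℝ) : ℂ) =
      -(Complex.I * (Real.pi * (turnCount β c₀ j : ℤ) / 6)) by push_cast; ring,
    Summit.CriticalPhenomena.CardyFormulaZ2.Theorems.WeakHolomorphy.Negative.stagger_entry_phase_eq_spin_shift]
  congr 1
  push_cast; ring

end Pathwise

/-! ## The identity for the dart observables -/

section Assembly

variable {E : DiscreteDobrushin}

/-- **The staggered Kirchhoff defect is the spin-`−5/3` corner sum.** For `ℤ²`-admissible Dobrushin data `E`, at EVERY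
medial vertex `p` and every reading mesh `δ ≠ 0`:
`F(NE) + F(SW) − F(NW) − F(SE) = ε₀ · Σ_k F^{(−5/3)}(c_{p,k})` with `F = bondDartObservable E δ (1/3)`,
`F^{(−5/3)} = bondDartObservable E δ (−5/3)` and the sign `ε₀ = (−1)^{c₀.2 + 1}` of the start corner `c₀` of `E`.
[cite: DuminilCopinSmirnov2012Lattice, §8.3] -/
theorem staggeredKirchhoff_eq_spinShift (hE : E.IsZdAdmissible) (p : Site 2 × Fin 2) {δ : ℝ} (hδ : δ ≠ 0) :
    bondDartObservable E δ (1 / 3) (medialCornersAt p.1 p.2 1) + bondDartObservable E δ (1 / 3) (medialCornersAt p.1 p.2 3) -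
        bondDartObservable E δ (1 / 3) (medialCornersAt p.1 p.2 0) - bondDartObservable E δ (1 / 3) (medialCornersAt p.1 p.2 2) =
      (-1 : ℂ) ^ ((startCorner hE).2.val + 1) *
        ∑ k : Fin 4, bondDartObservable E δ (-5 / 3) (medialCornersAt p.1 p.2 k) := by
  classical
  -- pathwise identity
  have hpath : ∀ ω, Parafermion.dartPhaseSum (medialExploration E ω) δ (1 / 3) (medialCornersAt p.1 p.2 1) +
        Parafermion.dartPhaseSum (medialExploration E ω) δ (1 / 3) (medialCornersAt p.1 p.2 3) -
        Parafermion.dartPhaseSum (medialExploration E ω) δ (1 / 3) (medialCornersAt p.1 p.2 0) -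
        Parafermion.dartPhaseSum (medialExploration E ω) δ (1 / 3) (medialCornersAt p.1 p.2 2) =
      (-1 : ℂ) ^ ((startCorner hE).2.val + 1) *
        ∑ k : Fin 4, Parafermion.dartPhaseSum (medialExploration E ω) δ (-5 / 3) (medialCornersAt p.1 p.2 k) := by
    intro ω
    set c₀ := startCorner hE with hc₀def
    set N := exitTime hE ω
    set β := E.bcBondConfig ω
    have key : ∀ r : Site 2 × Fin 4, Parafermion.dartPhaseSum (explorationList β c₀ N) δ (-5 / 3) (r.1, cFace r) =
        (-1 : ℂ) ^ (r.2.val + c₀.2.val) * Parafermion.dartPhaseSum (explorationList β c₀ N) δ (1 / 3) (r.1, cFace r) :=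
      fun r => (signed_dartPhaseSum_third_eq hδ N r).symm
    have hsgn : ∀ n : ℕ, (-1 : ℂ) ^ (c₀.2.val + 1) * (-1 : ℂ) ^ (n + c₀.2.val) = (-1) ^ (n + 1) := by
      intro n
      rw [← pow_add, show c₀.2.val + 1 + (n + c₀.2.val) = (n + 1) + 2 * c₀.2.val by ring, pow_add, pow_mul]
      norm_num
    rw [medialExploration_eq_explorationList hE ω, Fin.sum_univ_four]
    obtain ⟨x, i⟩ := p
    obtain rfl | rfl : i = 0 ∨ i = 1 := by fin_cases i <;> simp
    · -- horizontal: NW = (x,0), NE = (x+e₀,1), SE = (x+e₀,2), SW = (x,3) as coded corners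
      have e0 : medialCornersAt x 0 0 = ((x, (0 : Fin 4)).1, cFace (x, (0 : Fin 4))) := by
        simp [medialCornersAt, cFace, faceAt, cornerOff]
      have e1 : medialCornersAt x 0 1 = ((x + Pi.single 0 1, (1 : Fin 4)).1, cFace (x + Pi.single 0 1, (1 : Fin 4))) := by
        simp [medialCornersAt, cFace, faceAt, cornerOff]
      have e2 : medialCornersAt x 0 2 = ((x + Pi.single 0 1, (2 : Fin 4)).1, cFace (x + Pi.single 0 1, (2 : Fin 4))) := by
        simp [medialCornersAt, cFace, faceAt, cornerOff]; abel
      have e3 : medialCornersAt x 0 3 = ((x, (3 : Fin 4)).1, cFace (x, (3 : Fin 4))) := by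
        simp [medialCornersAt, cFace, faceAt, cornerOff]
      simp only
      rw [e0, e1, e2, e3, key, key, key, key, Fin.val_zero, Fin.val_one, Fin.val_two, show (3 : Fin 4).val = 3 from rfl]
      have s0 := hsgn 0; have s1 := hsgn 1; have s2 := hsgn 2; have s3 := hsgn 3
      rw [mul_add, mul_add, mul_add, ← mul_assoc, ← mul_assoc, ← mul_assoc, ← mul_assoc, s0, s1, s2, s3]
      ring
    · -- vertical: NW = (x+e₁,2), NE = (x+e₁,3), SE = (x,0), SW = (x,1) as coded corners
      have e0 : medialCornersAt x 1 0 = ((x + Pi.single 1 1, (2 : Fin 4)).1, cFace (x + Pi.single 1 1, (2 : Fin 4))) := by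
        simp [medialCornersAt, cFace, faceAt, cornerOff]
      have e1 : medialCornersAt x 1 1 = ((x + Pi.single 1 1, (3 : Fin 4)).1, cFace (x + Pi.single 1 1, (3 : Fin 4))) := by
        simp [medialCornersAt, cFace, faceAt, cornerOff]
      have e2 : medialCornersAt x 1 2 = ((x, (0 : Fin 4)).1, cFace (x, (0 : Fin 4))) := by
        simp [medialCornersAt, cFace, faceAt, cornerOff]
      have e3 : medialCornersAt x 1 3 = ((x, (1 : Fin 4)).1, cFace (x, (1 : Fin 4))) := by
        simp [medialCornersAt, cFace, faceAt, cornerOff]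
      simp only
      rw [e0, e1, e2, e3, key, key, key, key, Fin.val_zero, Fin.val_one, Fin.val_two, show (3 : Fin 4).val = 3 from rfl]
      have s0 := hsgn 0; have s1 := hsgn 1; have s2 := hsgn 2; have s3 := hsgn 3
      rw [mul_add, mul_add, mul_add, ← mul_assoc, ← mul_assoc, ← mul_assoc, ← mul_assoc, s2, s3, s0, s1]
      ring
  -- integrate
  have hint : ∀ σ c, Integrable (fun ω => Parafermion.dartPhaseSum (medialExploration E ω) δ σ c)
      (bondPercolation (zdGraph 2) half) := fun σ c => integrable_dartPhaseSum_exploration E δ σ c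
  set f : Fin 4 → BondConfig (Site 2) → ℂ := fun k ω =>
    Parafermion.dartPhaseSum (medialExploration E ω) δ (1 / 3) (medialCornersAt p.1 p.2 k) with hf
  set g : Fin 4 → BondConfig (Site 2) → ℂ := fun k ω =>
    Parafermion.dartPhaseSum (medialExploration E ω) δ (-5 / 3) (medialCornersAt p.1 p.2 k) with hg
  have hfi : ∀ k, Integrable (f k) (bondPercolation (zdGraph 2) half) := fun k => hint _ _
  have hgi : ∀ k, Integrable (g k) (bondPercolation (zdGraph 2) half) := fun k => hint _ _
  have hAB : Integrable (fun ω => f 1 ω + f 3 ω) (bondPercolation (zdGraph 2) half) := (hfi 1).add (hfi 3)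
  have hABC : Integrable (fun ω => f 1 ω + f 3 ω - f 0 ω) (bondPercolation (zdGraph 2) half) := hAB.sub (hfi 0)
  have hL : bondDartObservable E δ (1 / 3) (medialCornersAt p.1 p.2 1) + bondDartObservable E δ (1 / 3) (medialCornersAt p.1 p.2 3) -
        bondDartObservable E δ (1 / 3) (medialCornersAt p.1 p.2 0) - bondDartObservable E δ (1 / 3) (medialCornersAt p.1 p.2 2) =
      ∫ ω, (f 1 ω + f 3 ω - f 0 ω - f 2 ω) ∂(bondPercolation (zdGraph 2) half) := by
    rw [integral_sub hABC (hfi 2), integral_sub hAB (hfi 0), integral_add (hfi 1) (hfi 3)]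
    simp only [hf, Parafermion.bondDartObservable_def]
  have hR : (-1 : ℂ) ^ ((startCorner hE).2.val + 1) * ∑ k : Fin 4, bondDartObservable E δ (-5 / 3) (medialCornersAt p.1 p.2 k) =
      ∫ ω, (-1 : ℂ) ^ ((startCorner hE).2.val + 1) * ∑ k : Fin 4, g k ω ∂(bondPercolation (zdGraph 2) half) := by
    rw [integral_const_mul, integral_finsetSum _ (fun k _ => hgi k)]
    simp only [hg, Parafermion.bondDartObservable_def]
  rw [hL, hR]
  exact integral_congr_ae (ae_of_all _ fun ω => hpath ω)

/-- **Registered one-line form of `staggeredKirchhoff_eq_spinShift`**: for admissible data there is ONE sign `ε = ±1` (that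
of the start corner) with `F(NE)+F(SW)−F(NW)−F(SE) = ε · Σ_k F^{(−5/3)}(c_{p,k})` at every medial vertex `p` and every reading
mesh — the staggered Kirchhoff defect of the spin-`1/3` dart observable is the corner sum of its spin-`−5/3` alias.
[cite: DuminilCopinSmirnov2012Lattice, §8.3] -/
theorem stub_staggeredKirchhoffEqSpinShift : ∀ (E : DiscreteDobrushin), E.IsZdAdmissible → ∃ ε : ℂ, (ε = 1 ∨ ε = -1) ∧ ∀ (p : Site 2 × Fin 2) (δ : ℝ), δ ≠ 0 → bondDartObservable E δ (1 / 3) (medialCornersAt p.1 p.2 1) + bondDartObservable E δ (1 / 3) (medialCornersAt p.1 p.2 3) - bondDartObservable E δ (1 / 3) (medialCornersAt p.1 p.2 0) - bondDartObservable E δ (1 / 3) (medialCornersAt p.1 p.2 2) = ε * ∑ k : Fin 4, bondDartObservable E δ (-5 / 3) (medialCornersAt p.1 p.2 k) := by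
  intro E hE
  refine ⟨(-1 : ℂ) ^ ((startCorner hE).2.val + 1), ?_, fun p δ hδ => staggeredKirchhoff_eq_spinShift hE p hδ⟩
  rcases Nat.even_or_odd ((startCorner hE).2.val + 1) with h | h
  · exact Or.inl h.neg_one_pow
  · exact Or.inr h.neg_one_pow

end Assembly

end Summit.CriticalPhenomena.CardyFormulaZ2.Theorems.WeakHolomorphy.SplitBypass

end
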